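/-
Copyright: lit-balaban Phase-2 proof seat p31 (gen 2).  Statement-level skeleton of a published paper; no proof claims beyond what the
kernel checks below.
-/
import Literature.MathematicalPhysics.QuantumFieldTheory.BalabanImbrieJaffe1984to88.BIJ85Eq224ProofPart2
import Literature.MathematicalPhysics.QuantumFieldTheory.BalabanImbrieJaffe1984to88.BIJ85Eq531Inputs
import Literature.MathematicalPhysics.QuantumFieldTheory.Balaban1983to89.B5Eq118OneStroke

/-!
# `BalabanImbrieJaffe1984to88.BIJ85Eq224Base0` — T. Bałaban, J. Imbrie, A. Jaffe, *Renormalization of the Higgs model: minimizers,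
propagators and the stability of mean field theory*, Commun. Math. Phys. **97** (1985) 299–329 [BalabanImbrieJaffe1985]: the k-fold
operators of **(2.24)** with a NAMED coarse level, their base-0 forms, and the bridge `Q^s_k = (Q^s)^k` between the block-size-`L^k`
geometry and the composites

statement-level skeleton of published theorems with citation tags; proofs where landed; nothing here is a claim about the Yang–Mills mass gap

PDF held: `paper:balaban1985-cmp97-bij-higgs-minimizers` (journal page = PDF page + 298).  Pages read as images:
`run/shared/lean/pub/lit-balaban/lit-balaban-r15/pages/1985-cmp97-bij-higgs-minimizers-p007-x2.png` (p. 305), `…-p019-x2.png` (p. 317).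

CITATION HEADER (lean-in-tree rule).  Part of the lit-balaban TYPED SKELETON (HOME `run/shared/lean/pub/lit-balaban/`), Phase-2 seat p31
(gen 2), row **C1.Eq2.24** of `HOME/SKELETON.md`; companion of `BIJ85Eq224Proof`/`BIJ85Eq224ProofPart2` (the k-fold surface / edge
geometries `torusBlockBondsIter P i k`, `torusEdgeCellsIter P i k hd` of the tori, coarse level `i + k`) and of `BIJ85Eq531Inputs` (seat
p30: the k-fold COMPOSITES `QsstarIter k`, `QestarIter hd k` from `T^{(k)}` down to `T^{(0)}`).  WHAT IS REPRODUCED, and how.  p. 305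
[PDF 7], verbatim: *"We also need the k-fold averaging operators Q_k ≡ (Q)^k, etc. Especially important are Q^e_k ≡ (Q^e)^k and
Q^s_k = (Q^s)^k which satisfy Q^e_kQ^{e*}_k = L^{2k}I = η^{−2}I, Q^s_kQ^{s*}_k = L^kI = η^{−1}I, (2.24) where η = L^{−k}."*  The tree
names the finest torus `T^{(0)}` the source of every k-fold operator (`LatticeFieldCalculus.bondAvgIter k : T^{(0)} → T^{(k)}` = Q_k,
`BIJ85AxialPropagator411.deltaAx`, `B5Eq118OneStroke.iterBlockOf k`), whereas the block map `B7SectAStatements.blockOfIter k` of the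
geometries lands in `Site P (i + k)` — at `i = 0` the level `0 + k`, which Lean does not identify with `k` definitionally.  Here:
* §1 the same geometries WITH THE COARSE LEVEL AS A PARAMETER, `torusBlockBondsTo P i k n h` / `torusEdgeCellsTo P i k n h hd`
  (`h : i + k = n`; the k-fold block point transported along `h`), DEFINITIONALLY the structures of `BIJ85Eq224Proof(Part2)` at
  `n = i + k` (`torusBlockBondsTo_eq`, `torusEdgeCellsTo_eq`), with their theorems transported along `h`: the nestings
  `Q^{s*}_{k+1} = Q^{s*}_kQ^{s*}`, `Q^s_{k+1} = Q^sQ^s_k` (and edge versions), the counts, **(2.24)** both parts, and `∂Q^{s*}_k = Q^{e*}_k∂`;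
* §2 the BASE-0 forms (`i = 0`, `n = k`, bond fields on `PBond P k`): the block map IS `B5Eq118OneStroke.iterBlockOf k` (`blk_base0`,
  hence `x ∈ B^k(y)` of [Balaban1984PropagatorsI] (1.18), `mem_Bs_base0_iff`), and **the printed `Q^s_k = (Q^s)^k`**: seat p30's
  composites ARE the pull-backs of the block-size-`L^k` geometry, `QsstarIter k = Q^{s*}_k`, `QestarIter hd k = Q^{e*}_k`
  (`QsstarIter_eq`, `QestarIter_eq`), so that **(2.24) holds for the composites** (`Qs_QsstarIter531`, `Qe_QestarIter531`, η-forms).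
Standing range of `Setup` throughout (`n ≤ m + K`).  Nothing is restated: every theorem of §1 is a one-line transport (`subst`) of the
corresponding theorem of `BIJ85Eq224Proof(Part2)`.  Unit `lit-balaban-p31` (literature-prover-lit-balaban-p31-g2-0), 2026-08-21.
-/

open scoped BigOperators

namespace Literature.MathematicalPhysics.QuantumFieldTheory.BalabanImbrieJaffe1984to88.BIJ85Eq224Base0

open Literature.MathematicalPhysics.QuantumFieldTheory.Balaban1983to89
open BIJ85Sect2SurfaceAverages BIJ85CellAverages LatticeFieldCalculus BIJ85Eq219Proof BIJ85CurlQsstar BIJ85Eq224Proof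
  BIJ85Eq224ProofPart2 B7SectAStatements

variable {P : Params} {i : ℕ}

/-! ## 1. The k-fold geometries with a named coarse level `n = i + k` -/

/-- The k-fold two-scale bond geometry of the tori (`BIJ85Eq224Proof.torusBlockBondsIter`: *"(2.13), where L is replaced by L^k"*,
p. 309) with the coarse level `n` as a parameter and the proof `h : i + k = n` transporting the k-fold block point `blockOfIter k x :
Site P (i + k)` to `Site P n`; block size `L^k`.  At `n = i + k`, `h = rfl` it IS `torusBlockBondsIter P i k` (`torusBlockBondsTo_eq`).
[cite: BalabanImbrieJaffe1985, (2.24) p.305] -/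
@[reducible] noncomputable def torusBlockBondsTo (P : Params) (i k n : ℕ) (h : i + k = n) : BlockBonds where
  X := Balaban1983to89.Site P i
  Y := Balaban1983to89.Site P n
  FB := PBond P i
  CB := PBond P n
  fbFintype := inferInstance
  cbFintype := inferInstance
  fbDecEq := Classical.decEq _
  yDecEq := inferInstance
  src := PBond.src
  tgt := PBond.tgt
  csrc := PBond.src
  ctgt := PBond.tgt
  blk x := cast (congrArg (Balaban1983to89.Site P) h) (blockOfIter k x)
  L := P.L ^ k
  d := P.d
  one_le_L := Nat.one_le_pow _ _ P.L_pos
  one_le_d := P.hd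
  cbond_ext := (torusBlockBondsIter P n 0).cbond_ext
  cbond_ne := (torusBlockBondsIter P n 0).cbond_ne

/-- kernel: at the coarse level `i + k` itself the named-level geometry IS `torusBlockBondsIter P i k` (definitionally).
[cite: BalabanImbrieJaffe1985, (2.24) p.305] -/
theorem torusBlockBondsTo_eq (i k : ℕ) : torusBlockBondsTo P i k (i + k) rfl = torusBlockBondsIter P i k := rfl

/-- The k-fold edge-plaquette geometry of the tori (`BIJ85Eq224ProofPart2.torusEdgeCellsIter`, exponent `m = 2`, block size `L^k`) with
the coarse level `n` as a parameter (`h : i + k = n`); at `n = i + k` it IS `torusEdgeCellsIter P i k hd` (`torusEdgeCellsTo_eq`).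
[cite: BalabanImbrieJaffe1985, (2.24) p.305] -/
@[reducible] noncomputable def torusEdgeCellsTo (P : Params) (i k n : ℕ) (h : i + k = n) (hd : 2 ≤ P.d) : Cells where
  F := Plaq P i
  C := Plaq P n
  fF := inferInstance
  fC := inferInstance
  dF := Classical.decEq _
  dC := Classical.decEq _
  cell p := if blockOfIter k (p.src.shift p.μ) = (blockOfIter k p.src).shift p.μ ∧
      blockOfIter k (p.src.shift p.ν) = (blockOfIter k p.src).shift p.ν
    then some ⟨cast (congrArg (Balaban1983to89.Site P) h) (blockOfIter k p.src), p.μ, p.ν, p.hμν⟩ else none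
  L := P.L ^ k
  d := P.d
  m := 2
  one_le_L := Nat.one_le_pow _ _ P.L_pos
  m_le_d := hd

/-- kernel: at the coarse level `i + k` the named-level edge geometry IS `torusEdgeCellsIter P i k hd` (definitionally).
[cite: BalabanImbrieJaffe1985, (2.24) p.305] -/
theorem torusEdgeCellsTo_eq (i k : ℕ) (hd : 2 ≤ P.d) : torusEdgeCellsTo P i k (i + k) rfl hd = torusEdgeCellsIter P i k hd := rfl

/-- `Q^{s*}_0 = I` at a named level (block size 1). [cite: BalabanImbrieJaffe1985, (2.24) p.305] -/
theorem QsstarTo_zero (h : i + 0 = i) (B : PBond P i → ℝ) : (torusBlockBondsTo P i 0 i h).Qsstar B = B :=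
  BIJ85Eq224Proof.QsstarIter_zero B

/-- `Q^s_0 = I` at a named level (block size 1). [cite: BalabanImbrieJaffe1985, (2.24) p.305] -/
theorem QsTo_zero (h : i + 0 = i) (A : PBond P i → ℝ) : (torusBlockBondsTo P i 0 i h).Qs A = A :=
  BIJ85Eq224Proof.QsIter_zero A

/-- **`Q^{s*}_{k+1} = Q^{s*}_kQ^{s*}`** at named levels: the pull-back of block size `L^{k+1}` onto `T^{(i)}` from `T^{(n+1)}` is the
pull-back of block size `L^k` from `T^{(n)}` of the one-step pull-back (2.17) at level `n` (transport of
`BIJ85Eq224Proof.QsstarIter_succ`; standing range). [cite: BalabanImbrieJaffe1985, (2.24) p.305] -/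
theorem QsstarTo_succ {k n : ℕ} (h : i + k = n) (h' : i + (k + 1) = n + 1) (hn : n + 1 ≤ P.m + P.K)
    (B : PBond P (n + 1) → ℝ) :
    (torusBlockBondsTo P i (k + 1) (n + 1) h').Qsstar B =
      (torusBlockBondsTo P i k n h).Qsstar ((torusBlockBonds P n).Qsstar B) := by
  subst h
  exact BIJ85Eq224Proof.QsstarIter_succ hn B

/-- **`Q^s_{k+1} = Q^sQ^s_k`** (*"Q^s_k = (Q^s)^k"*) at named levels (transport of `BIJ85Eq224Proof.QsIter_succ`; standing range).
[cite: BalabanImbrieJaffe1985, (2.24) p.305] -/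
theorem QsTo_succ {k n : ℕ} (h : i + k = n) (h' : i + (k + 1) = n + 1) (hn : n + 1 ≤ P.m + P.K) (A : PBond P i → ℝ) :
    (torusBlockBondsTo P i (k + 1) (n + 1) h').Qs A = (torusBlockBonds P n).Qs ((torusBlockBondsTo P i k n h).Qs A) := by
  subst h
  exact BIJ85Eq224Proof.QsIter_succ hn A

/-- The count `|B^s_k(c)| = (L^k)^{d−1}` at a named level (transport of `BIJ85Eq224Proof.card_BsIter`; standing range).
[cite: BalabanImbrieJaffe1985, (2.24) p.305] -/
theorem card_BsTo {k n : ℕ} (h : i + k = n) (hn : n ≤ P.m + P.K) (c : PBond P n) :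
    ((torusBlockBondsTo P i k n h).Bs c).card = (P.L ^ k) ^ (P.d - 1) := by
  subst h
  exact card_BsIter k hn c

/-- **(2.24)**, surface part, at a named coarse level: `Q^s_kQ^{s*}_k = L^kI` outright on the tori (transport of
`BIJ85Eq224Proof.Qs_Qsstar_iter`; standing range). [cite: BalabanImbrieJaffe1985, (2.24) p.305] -/
theorem Qs_Qsstar_to {k n : ℕ} (h : i + k = n) (hn : n ≤ P.m + P.K) (B : PBond P n → ℝ) (c : PBond P n) :
    (torusBlockBondsTo P i k n h).Qs ((torusBlockBondsTo P i k n h).Qsstar B) c = (P.L : ℝ) ^ k * B c := by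
  subst h
  exact Qs_Qsstar_iter hn B c

/-- **(2.24)**, surface part in the η-form, at a named coarse level: `Q^s_kQ^{s*}_k = η^{−1}I`, `η = Params.eta k` (standing range).
[cite: BalabanImbrieJaffe1985, (2.24) p.305] -/
theorem Qs_Qsstar_to_eta {k n : ℕ} (h : i + k = n) (hn : n ≤ P.m + P.K) (B : PBond P n → ℝ) (c : PBond P n) :
    (torusBlockBondsTo P i k n h).Qs ((torusBlockBondsTo P i k n h).Qsstar B) c = (P.eta k)⁻¹ * B c := by
  subst h
  exact Qs_Qsstar_iter_eta hn B c

/-- `Q^{e*}_0 = I` at a named level (block size 1). [cite: BalabanImbrieJaffe1985, (2.24) p.305] -/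
theorem QestarTo_zero (h : i + 0 = i) (hd : 2 ≤ P.d) (g : Plaq P i → ℝ) : (torusEdgeCellsTo P i 0 i h hd).Qstar g = g :=
  BIJ85Eq224ProofPart2.QestarIter_zero hd g

/-- `Q^e_0 = I` at a named level (block size 1). [cite: BalabanImbrieJaffe1985, (2.24) p.305] -/
theorem QeTo_zero (h : i + 0 = i) (hd : 2 ≤ P.d) (f : Plaq P i → ℝ) : (torusEdgeCellsTo P i 0 i h hd).Q f = f :=
  BIJ85Eq224ProofPart2.QeIter_zero hd f

/-- **`Q^{e*}_{k+1} = Q^{e*}_kQ^{e*}`** at named levels (transport of `BIJ85Eq224ProofPart2.QestarIter_succ`; standing range).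
[cite: BalabanImbrieJaffe1985, (2.24) p.305] -/
theorem QestarTo_succ {k n : ℕ} (h : i + k = n) (h' : i + (k + 1) = n + 1) (hn : n + 1 ≤ P.m + P.K) (hd : 2 ≤ P.d)
    (g : Plaq P (n + 1) → ℝ) :
    (torusEdgeCellsTo P i (k + 1) (n + 1) h' hd).Qstar g =
      (torusEdgeCellsTo P i k n h hd).Qstar ((torusEdgeCells P n hd).Qstar g) := by
  subst h
  exact BIJ85Eq224ProofPart2.QestarIter_succ hn hd g

/-- **`Q^e_{k+1} = Q^eQ^e_k`** (p. 319) at named levels (transport of `BIJ85Eq224ProofPart2.QeIter_succ`; standing range).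
[cite: BalabanImbrieJaffe1985, (2.24) p.305] -/
theorem QeTo_succ {k n : ℕ} (h : i + k = n) (h' : i + (k + 1) = n + 1) (hn : n + 1 ≤ P.m + P.K) (hd : 2 ≤ P.d)
    (f : Plaq P i → ℝ) :
    (torusEdgeCellsTo P i (k + 1) (n + 1) h' hd).Q f = (torusEdgeCells P n hd).Q ((torusEdgeCellsTo P i k n h hd).Q f) := by
  subst h
  exact BIJ85Eq224ProofPart2.QeIter_succ hn hd f

/-- The count `|B^e_k(p′)| = (L^k)^{d−2}` at a named level (transport of `BIJ85Eq224ProofPart2.card_edgeBIter`; standing range).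
[cite: BalabanImbrieJaffe1985, (2.24) p.305] -/
theorem card_edgeBTo {k n : ℕ} (h : i + k = n) (hn : n ≤ P.m + P.K) (hd : 2 ≤ P.d) (p' : Plaq P n) :
    ((torusEdgeCellsTo P i k n h hd).B p').card = (P.L ^ k) ^ (P.d - 2) := by
  subst h
  exact card_edgeBIter hd k hn p'

/-- **(2.24)**, edge part, at a named coarse level: `Q^e_kQ^{e*}_k = L^{2k}I` outright on the tori (transport of
`BIJ85Eq224ProofPart2.Qe_Qestar_iter`; standing range, `2 ≤ d`). [cite: BalabanImbrieJaffe1985, (2.24) p.305] -/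
theorem Qe_Qestar_to {k n : ℕ} (h : i + k = n) (hn : n ≤ P.m + P.K) (hd : 2 ≤ P.d) (g : Plaq P n → ℝ) (p' : Plaq P n) :
    (torusEdgeCellsTo P i k n h hd).Q ((torusEdgeCellsTo P i k n h hd).Qstar g) p' = (P.L : ℝ) ^ (2 * k) * g p' := by
  subst h
  exact Qe_Qestar_iter hn hd g p'

/-- **(2.24)**, edge part in the η-form, at a named coarse level: `Q^e_kQ^{e*}_k = η^{−2}I`, `η = Params.eta k` (standing range,
`2 ≤ d`). [cite: BalabanImbrieJaffe1985, (2.24) p.305] -/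
theorem Qe_Qestar_to_eta {k n : ℕ} (h : i + k = n) (hn : n ≤ P.m + P.K) (hd : 2 ≤ P.d) (g : Plaq P n → ℝ) (p' : Plaq P n) :
    (torusEdgeCellsTo P i k n h hd).Q ((torusEdgeCellsTo P i k n h hd).Qstar g) p' = ((P.eta k)⁻¹) ^ 2 * g p' := by
  subst h
  exact Qe_Qestar_iter_eta hn hd g p'

/-- **`∂Q^{s*}_k = Q^{e*}_k∂`** (p. 317, p. 319, p. 323) at a named coarse level: `∂_{L^kc} ∘ Q^{s*}_k = Q^{e*}_k ∘ ∂_c` as maps from the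
bond fields of `T^{(n)}` to the plaquette fields of `T^{(i)}` (transport of `BIJ85Eq224ProofPart2.curl_QsstarIter`; standing range,
`2 ≤ d`). [cite: BalabanImbrieJaffe1985, (5.3.1) p.317] -/
theorem curl_QsstarTo {k n : ℕ} (h : i + k = n) (hn : n ≤ P.m + P.K) (hd : 2 ≤ P.d) (c : ℝ) (B : PBond P n → ℝ) :
    curl ((P.L : ℝ) ^ k * c) ((torusBlockBondsTo P i k n h).Qsstar B) = (torusEdgeCellsTo P i k n h hd).Qstar (curl c B) := by
  subst h
  exact BIJ85Eq224ProofPart2.curl_QsstarIter hd k hn c B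

/-- **`Q^{e*}_k∂ = ∂Q^{s*}_k`** in the units of Sects. 4–7 (`∂` with factor `η⁻¹ = L^k` on the fine torus, factor `1` on `T^{(n)}`) at a
named coarse level (transport of `BIJ85Eq224ProofPart2.curl_eta_QsstarIter`; standing range, `2 ≤ d`).
[cite: BalabanImbrieJaffe1985, (7.1.18) p.323] -/
theorem curl_eta_QsstarTo {k n : ℕ} (h : i + k = n) (hn : n ≤ P.m + P.K) (hd : 2 ≤ P.d) (B : PBond P n → ℝ) :
    curl (P.eta k)⁻¹ ((torusBlockBondsTo P i k n h).Qsstar B) = (torusEdgeCellsTo P i k n h hd).Qstar (curl 1 B) := by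
  subst h
  exact curl_eta_QsstarIter hd hn B

/-! ## 2. Base 0: the k-fold operators from `T^{(0)}` (block map = `B5Eq118OneStroke.iterBlockOf`) and `Q^s_k = (Q^s)^k` for the
composites of `BIJ85Eq531Inputs` -/

/-- kernel: transporting a one-step block point along an identification of levels commutes with `blockOf`. [folklore] -/
private theorem cast_blockOf {n n' : ℕ} (e : n = n') (y : Balaban1983to89.Site P n) :
    cast (congrArg (fun m => Balaban1983to89.Site P (m + 1)) e) (blockOf y) =
      blockOf (cast (congrArg (Balaban1983to89.Site P) e) y) := by
  subst e
  rfl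

/-- AT BASE 0 THE BLOCK MAP IS THE TREE'S `B^k`: the k-fold block point of the named-level geometry from `T^{(0)}` to `T^{(k)}` is
`B5Eq118OneStroke.iterBlockOf k` ([Balaban1984PropagatorsI] (1.18): `x ∈ B^k(y)`), so its surface sets are the corridors between the
blocks `B5Eq118OneStroke.iterBlock k` of order `k`. [cite: BalabanImbrieJaffe1985, (2.24) p.305] -/
theorem blk_base0 : ∀ (k : ℕ) (x : Balaban1983to89.Site P 0),
    (torusBlockBondsTo P 0 k k (Nat.zero_add k)).blk x = B5Eq118OneStroke.iterBlockOf k x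
  | 0, _ => rfl
  | k + 1, x => by
    show cast (congrArg (Balaban1983to89.Site P) (Nat.zero_add (k + 1))) (blockOf (blockOfIter k x)) =
      blockOf (B5Eq118OneStroke.iterBlockOf k x)
    rw [← blk_base0 k x]
    exact cast_blockOf (Nat.zero_add k) (blockOfIter k x)

/-- kernel: membership in the k-fold surface set from `T^{(0)}`, cast-free: `b₋ ∈ B^k(c₋)` and `b₊ ∈ B^k(c₊)` with `B^k` =
`B5Eq118OneStroke.iterBlock k` (standing range not needed). [cite: BalabanImbrieJaffe1985, (4.5.3) p.312] -/
theorem mem_Bs_base0_iff (k : ℕ) (c : PBond P k) (b : PBond P 0) :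
    b ∈ (torusBlockBondsTo P 0 k k (Nat.zero_add k)).Bs c ↔
      b.src ∈ B5Eq118OneStroke.iterBlock k c.src ∧ b.tgt ∈ B5Eq118OneStroke.iterBlock k c.tgt := by
  rw [(torusBlockBondsTo P 0 k k (Nat.zero_add k)).mem_Bs, B5Eq118OneStroke.mem_iterBlock, B5Eq118OneStroke.mem_iterBlock]
  show (torusBlockBondsTo P 0 k k (Nat.zero_add k)).blk b.src = c.src ∧
      (torusBlockBondsTo P 0 k k (Nat.zero_add k)).blk b.tgt = c.tgt ↔ _
  rw [blk_base0, blk_base0]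

/-- **`Q^s_k = (Q^s)^k`, adjoint form, ON THE NOSE**: seat p30's k-fold composite `BIJ85Eq531Inputs.QsstarIter k` (the k-fold product of
the one-step pull-backs (2.17), `T^{(k)} → T^{(0)}`) IS the pull-back `Q^{s*}_k` of the block-size-`L^k` geometry from `T^{(0)}` to
`T^{(k)}` (standing range `k ≤ m + K`). [cite: BalabanImbrieJaffe1985, (2.24) p.305] -/
theorem QsstarIter_eq : ∀ (k : ℕ), k ≤ P.m + P.K → ∀ (B : PBond P k → ℝ),
    BIJ85Eq531Inputs.QsstarIter k B = (torusBlockBondsTo P 0 k k (Nat.zero_add k)).Qsstar B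
  | 0, _, B => (QsstarTo_zero (i := 0) rfl B).symm
  | k + 1, hk, B => by
    rw [BIJ85Eq531Inputs.QsstarIter_succ, QsstarIter_eq k (by omega),
      QsstarTo_succ (Nat.zero_add k) (Nat.zero_add (k + 1)) hk B]

/-- **`Q^e_k = (Q^e)^k`, adjoint form, ON THE NOSE**: seat p30's composite `BIJ85Eq531Inputs.QestarIter hd k` IS the pull-back `Q^{e*}_k`
of the block-size-`L^k` edge geometry from `T^{(0)}` to `T^{(k)}` (standing range, `2 ≤ d`). [cite: BalabanImbrieJaffe1985, (2.24) p.305] -/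
theorem QestarIter_eq (hd : 2 ≤ P.d) : ∀ (k : ℕ), k ≤ P.m + P.K → ∀ (g : Plaq P k → ℝ),
    BIJ85Eq531Inputs.QestarIter hd k g = (torusEdgeCellsTo P 0 k k (Nat.zero_add k) hd).Qstar g
  | 0, _, g => (QestarTo_zero (i := 0) rfl hd g).symm
  | k + 1, hk, g => by
    rw [BIJ85Eq531Inputs.QestarIter_succ, QestarIter_eq hd k (by omega),
      QestarTo_succ (Nat.zero_add k) (Nat.zero_add (k + 1)) hk hd g]

/-- **(2.24)** FOR THE COMPOSITES, surface part, verbatim *"Q^s_kQ^{s*}_k = L^kI = η^{−1}I"*: with `Q^{s*}_k` = seat p30's composite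
`BIJ85Eq531Inputs.QsstarIter k` and `Q^s_k` = the surface average (2.16) at block size `L^k` from `T^{(0)}`, outright on the tori
(standing range). [cite: BalabanImbrieJaffe1985, (2.24) p.305] -/
theorem Qs_QsstarIter531 {k : ℕ} (hk : k ≤ P.m + P.K) (B : PBond P k → ℝ) (c : PBond P k) :
    (torusBlockBondsTo P 0 k k (Nat.zero_add k)).Qs (BIJ85Eq531Inputs.QsstarIter k B) c = (P.L : ℝ) ^ k * B c := by
  rw [QsstarIter_eq k hk B]
  exact Qs_Qsstar_to (Nat.zero_add k) hk B c

/-- **(2.24)** FOR THE COMPOSITES, surface part in the η-form `= η^{−1}I` (standing range). [cite: BalabanImbrieJaffe1985, (2.24) p.305] -/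
theorem Qs_QsstarIter531_eta {k : ℕ} (hk : k ≤ P.m + P.K) (B : PBond P k → ℝ) (c : PBond P k) :
    (torusBlockBondsTo P 0 k k (Nat.zero_add k)).Qs (BIJ85Eq531Inputs.QsstarIter k B) c = (P.eta k)⁻¹ * B c := by
  rw [QsstarIter_eq k hk B]
  exact Qs_Qsstar_to_eta (Nat.zero_add k) hk B c

/-- **(2.24)** FOR THE COMPOSITES, edge part, verbatim *"Q^e_kQ^{e*}_k = L^{2k}I"*: with `Q^{e*}_k` = seat p30's composite
`BIJ85Eq531Inputs.QestarIter hd k` and `Q^e_k` = the edge average (2.21) at block size `L^k` from `T^{(0)}` (standing range, `2 ≤ d`).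
[cite: BalabanImbrieJaffe1985, (2.24) p.305] -/
theorem Qe_QestarIter531 (hd : 2 ≤ P.d) {k : ℕ} (hk : k ≤ P.m + P.K) (g : Plaq P k → ℝ) (p' : Plaq P k) :
    (torusEdgeCellsTo P 0 k k (Nat.zero_add k) hd).Q (BIJ85Eq531Inputs.QestarIter hd k g) p' = (P.L : ℝ) ^ (2 * k) * g p' := by
  rw [QestarIter_eq hd k hk g]
  exact Qe_Qestar_to (Nat.zero_add k) hk hd g p'

/-- **(2.24)** FOR THE COMPOSITES, edge part in the η-form `= η^{−2}I` (standing range, `2 ≤ d`). [cite: BalabanImbrieJaffe1985, (2.24) p.305] -/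
theorem Qe_QestarIter531_eta (hd : 2 ≤ P.d) {k : ℕ} (hk : k ≤ P.m + P.K) (g : Plaq P k → ℝ) (p' : Plaq P k) :
    (torusEdgeCellsTo P 0 k k (Nat.zero_add k) hd).Q (BIJ85Eq531Inputs.QestarIter hd k g) p' = ((P.eta k)⁻¹) ^ 2 * g p' := by
  rw [QestarIter_eq hd k hk g]
  exact Qe_Qestar_to_eta (Nat.zero_add k) hk hd g p'

end Literature.MathematicalPhysics.QuantumFieldTheory.BalabanImbrieJaffe1984to88.BIJ85Eq224Base0
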